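import Summits.BirchSwinnertonDyer.BirchSwinnertonDyer.Theorems.AlignedTransportAtTwoMainConjectureTransportAlignedAtTwoSharedCubicField
import Literature.NumberTheory.EllipticCurves.ManinConstantQuadraticTwistAtTwoOrdinaryProofs
import Mathlib.NumberTheory.Padics.Hensel
import HarnessLib

/-!
# Route `AlignedTransportAtTwo`, crux C1 `MainConjectureTransportAlignedAtTwo` (stmt-BirchSwinnertonDyer-22296), line `birth`:
# the KILFORD-STRATUM DICTIONARY at `2` — on the good-ordinary locus, «ON the Kilford stratum» ⟺ «`Δ` is a square in `ℚ₂`»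

Cell `bsd-f1-sign2`, WIDTH-5 attach seat `bsd-line-att-p4` g11 (`--supports stmt-BirchSwinnertonDyer-22296`). THEOREMS ONLY
(no `def`, no named fact, no `sorry`); pure algebra / `2`-adic arithmetic. BSD is not proved by this; C1 is not closed by this.

WHY. The route's named partition of the analytic line law at `2` is by the KILFORD STRATUM
(`F1Sign2.OnKilfordStratumAtTwo W := ((twoDivisionUCubic W).map (algebraMap ℚ ℚ_[2])).Splits`; halves
`F1Sign2.AnalyticLineTransferAtTwoOnStratum` / `…OffStratum`, consumer `…Theorems.AlignedTransportAtTwo….mainConjectureTransportAlignedAtTwo_of_facts_of_strata`),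
while the line's Buzzard-multiplicity-one road (lead att-p1 g9, `…BuzzardGalois`, `…SharedCubicTorsion`) carries the LOCAL hypothesis in the
shape `hΔ₂ : ∀ s : ℚ_[2], s ^ 2 ≠ (W.Δ : ℚ_[2])` and asserts in prose that «for a good-ordinary `S₃` curve this says exactly OFF the Kilford
stratum». This file proves that sentence and its companions, so that the residual of the line (the lead's planned v22/v23 reshape: «Kilford
stratum ∪ `Δ > 0` locus») can be stated in the route's named vocabulary and decided per curve from `Δ_min mod 8`.

* §1 (any field `K ⊇ ℚ`, any `W`): `isSquare_ratCast_Δ_of_splits_map` — the `u`-cubic splits over `K` ⇒ `Δ(W)` is a square in `K`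
  (`256Δ = ((u₂ − u₃)·c′(u₁))²`, from the tree's discriminant identity `…SharedCubicField.quadDisc_mul_derivSq_eq`); conversely
  `splits_map_of_root_of_isSquare_ratCast_Δ` — a root in `K` + `Δ ∈ K²` ⇒ splitting (`W` elliptic).
* §2 (Hensel): `exists_padicInt_root_of_isOrdinaryAt_two` — good ORDINARY reduction at `2` ⇒ the `u`-cubic of the minimal equation has an
  odd-unit root in `ℤ₂` (`b₂ = a₁² + 4a₂` is odd by the tree's `odd_a₁_of_hasGoodReductionAtPrime_two_of_odd_frobeniusTrace_two`, so the cubic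
  is `ū²(ū + 1)` mod `2` and `ū = 1` lifts by `hensels_lemma`) — the abscissa `e/4` of the canonical-subgroup `2`-torsion point.
* §3 THE DICTIONARY (good ordinary at `2`): `onKilfordStratumAtTwo_iff_isSquare_padic_Δ`, and its negated form
  `not_onKilfordStratumAtTwo_iff_forall_sq_ne : ¬ OnKilfordStratumAtTwo W ↔ ∀ s : ℚ_[2], s ^ 2 ≠ Δ(W)` (right side = the line's `hΔ₂`
  VERBATIM); the unconditional halves `isSquare_padic_Δ_of_onKilfordStratumAtTwo` / `not_onKilfordStratumAtTwo_of_forall_sq_ne` (any `W`);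
  and `exists_roots_map_eq_singleton_of_not_onKilfordStratumAtTwo` — OFF the stratum the `ℚ₂`-roots of the cubic are `{e}`, `e ∈ ℤ₂^×`
  (exactly one `ℚ₂`-rational `2`-torsion point: `ρ̄_{W,2}(D₂)` has order `2`).

The companion file `…KilfordStratumShared` proves that the stratum is a property of the crux's SHARED cubic field, the decidable form
`OnKilfordStratumAtTwo W ↔ Δ_min(W) ≡ 1 (mod 8)`, and the two-curve consequences.

References: Silverman AEC III.1 (b-invariants, `Δ` and the `2`-division cubic), VII.2 [SilvermanAEC2009]; Kilford, JNT 97 (2002) [Kilford2002];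
Kilford–Wiese, Exp. Math. 17 (2008) Thm 1.2–1.3 (the stratum = `ρ̄_𝔪(Frob₂)` scalar) [KilfordWiese2008]; Buzzard, MRL 7 (2000) Prop. 2.4
[Buzzard2000LevelLoweringModTwo].
-/

set_option autoImplicit false
-- justification: the `Summit.BirchSwinnertonDyer.BirchSwinnertonDyer.…` path repeats a component (route-file convention)
set_option linter.dupNamespace false

noncomputable section

open scoped Classical

open Polynomial WeierstrassCurve NumberField
open Literature.NumberTheory.EllipticCurves Literature.NumberTheory.EllipticCurves.Greenberg1999
open Summit.BirchSwinnertonDyer.Rank1Residual.F1Sign2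
open Summit.BirchSwinnertonDyer.BirchSwinnertonDyer.Theorems.AlignedTransportAtTwoBridge
open Summit.BirchSwinnertonDyer.BirchSwinnertonDyer.Theorems.AlignedTransportAtTwoSharedCubicField

namespace Summit.BirchSwinnertonDyer.BirchSwinnertonDyer.Theorems.AlignedTransportAtTwoKilfordStratum

/-! ## §1 One curve over any field of characteristic `0`: splitting of the `u`-cubic versus the square class of `Δ` -/

section AnyField

variable (W : WeierstrassCurve ℚ) {K : Type*} [Field K] [CharZero K]

/-- A root of the mapped `u`-cubic is a root in the `aeval` sense. [folklore] -/
theorem aeval_eq_zero_of_eval_map_eq_zero {e : K} (he : ((twoDivisionUCubic W).map (algebraMap ℚ K)).eval e = 0) :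
    aeval e (twoDivisionUCubic W) = 0 := by
  rwa [eval_map, ← aeval_def] at he

/-- **Splitting ⇒ `Δ` is a square.** If the `u`-cubic `c_W` splits over a field `K ⊇ ℚ`, then `Δ(W)` is a square in
`K`: with the roots `u₁, u₂, u₃ ∈ K`, `256·Δ = ((u₂ − u₃)·c_W′(u₁))²` (the discriminant identity of
`…SharedCubicField.quadDisc_mul_derivSq_eq`). [cite: SilvermanAEC2009, III.1 (Δ = 16·disc of the 2-division cubic)] -/
theorem isSquare_ratCast_Δ_of_splits_map (hspl : ((twoDivisionUCubic W).map (algebraMap ℚ K)).Splits) :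
    IsSquare (W.Δ : K) := by
  have hdeg : ((twoDivisionUCubic W).map (algebraMap ℚ K)).degree ≠ 0 := by
    rw [degree_map, degree_eq_natDegree (monic_twoDivisionUCubic W).ne_zero, natDegree_twoDivisionUCubic]
    norm_num
  obtain ⟨e, he'⟩ := hspl.exists_eval_eq_zero hdeg
  have he : aeval e (twoDivisionUCubic W) = 0 := aeval_eq_zero_of_eval_map_eq_zero W he'
  set s : K := (W.b₂ : K) + e with hs
  set t : K := e ^ 2 + (W.b₂ : K) * e + 8 * (W.b₄ : K) with htt
  set cp : K := 3 * e ^ 2 + 2 * (W.b₂ : K) * e + 8 * (W.b₄ : K) with hcp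
  have hD : (s ^ 2 - 4 * t) * cp ^ 2 = 256 * (W.Δ : K) := quadDisc_mul_derivSq_eq W he
  rw [map_twoDivisionUCubic_eq_mul W he, splits_X_sub_C_mul_iff] at hspl
  obtain ⟨hq2, hqm⟩ := natDegree_cofactor W e
  have hcard := (splits_iff_card_roots.mp hspl).trans hq2
  obtain ⟨u, v, huv⟩ := Multiset.card_eq_two.mp hcard
  have hev : ∀ x : K, x ^ 2 + s * x + t = (x - u) * (x - v) := fun x ↦ by
    have h := Splits.eval_eq_prod_roots_of_monic hspl hqm x
    rw [eval_cofactor, huv] at h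
    rw [← hs, ← htt] at h
    simpa using h
  have h0 := hev 0
  have h1 := hev 1
  have hsuv : s = -(u + v) := by linear_combination h1 - h0
  have htuv : t = u * v := by linear_combination h0
  have hst : s ^ 2 - 4 * t = (u - v) ^ 2 := by rw [hsuv, htuv]; ring
  refine ⟨(u - v) * cp / 16, ?_⟩
  linear_combination (-1 / 256 : K) * hD + ((1 / 256 : K) * cp ^ 2) * hst

/-- **A root in `K` and `Δ` a square in `K` ⇒ the `u`-cubic splits over `K`** (`W` elliptic): over `K` the cubic is
`(u − e)·q(u)` with `disc q · c_W′(e)² = 256Δ`; `c_W′(e) ≠ 0` because `Δ ≠ 0`, so `disc q = (16r/c_W′(e))²` and the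
quadratic cofactor `q` has the root `(−(b₂ + e) + 16r/c_W′(e))/2`. [cite: SilvermanAEC2009, III.1 (Δ = 16·disc of the 2-division cubic)] -/
theorem splits_map_of_root_of_isSquare_ratCast_Δ [W.IsElliptic] {e : K} (he : aeval e (twoDivisionUCubic W) = 0)
    (hsq : IsSquare (W.Δ : K)) : ((twoDivisionUCubic W).map (algebraMap ℚ K)).Splits := by
  obtain ⟨r, hr⟩ := hsq
  set s : K := (W.b₂ : K) + e with hs
  set t : K := e ^ 2 + (W.b₂ : K) * e + 8 * (W.b₄ : K) with htt
  set cp : K := 3 * e ^ 2 + 2 * (W.b₂ : K) * e + 8 * (W.b₄ : K) with hcp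
  have hD : (s ^ 2 - 4 * t) * cp ^ 2 = 256 * (W.Δ : K) := quadDisc_mul_derivSq_eq W he
  have hΔ0 : (W.Δ : K) ≠ 0 := by
    rw [Rat.cast_ne_zero]
    exact W.isUnit_Δ.ne_zero
  have hcp0 : cp ≠ 0 := by
    intro h0
    apply hΔ0
    have : 256 * (W.Δ : K) = 0 := by rw [← hD, h0]; ring
    linear_combination (1 / 256 : K) * this
  set w : K := 16 * r / cp with hw
  have hw2 : w ^ 2 = s ^ 2 - 4 * t := by
    rw [hw, div_pow]
    field_simp
    linear_combination (-256) * hr - hD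
  rw [map_twoDivisionUCubic_eq_mul W he, splits_X_sub_C_mul_iff]
  refine Splits.of_natDegree_eq_two (x := (-s + w) / 2) (natDegree_cofactor W e).1 ?_
  rw [eval_cofactor, ← hs, ← htt]
  linear_combination (1 / 4 : K) * hw2

/-- `Δ` not a square in `K` (in the shape `∀ s, s² ≠ Δ`) ⇒ the `u`-cubic does not split over `K`. [folklore] -/
theorem not_splits_map_of_forall_sq_ne (hΔ : ∀ s : K, s ^ 2 ≠ (W.Δ : K)) :
    ¬ ((twoDivisionUCubic W).map (algebraMap ℚ K)).Splits := by
  intro hspl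
  obtain ⟨r, hr⟩ := isSquare_ratCast_Δ_of_splits_map W hspl
  exact hΔ r (by rw [hr, sq])

end AnyField

/-! ## §2 Good ordinary reduction at `2`: the `u`-cubic has an odd-unit root in `ℤ₂` (Hensel) -/

section Hensel

variable (W : WeierstrassCurve ℚ) [W.IsGloballyMinimal]

/-- On a globally minimal equation, `b₂` is the integer `b₂` of the integral model. [folklore] -/
theorem ratCast_b₂_integralModelInt : ((integralModelInt W).b₂ : ℚ) = W.b₂ := by
  have h := (integralModelInt W).map_b₂ (Int.castRingHom ℚ)
  rw [map_integralModelInt, eq_intCast] at h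
  exact h.symm

/-- On a globally minimal equation, `b₄` is the integer `b₄` of the integral model. [folklore] -/
theorem ratCast_b₄_integralModelInt : ((integralModelInt W).b₄ : ℚ) = W.b₄ := by
  have h := (integralModelInt W).map_b₄ (Int.castRingHom ℚ)
  rw [map_integralModelInt, eq_intCast] at h
  exact h.symm

/-- On a globally minimal equation, `b₆` is the integer `b₆` of the integral model. [folklore] -/
theorem ratCast_b₆_integralModelInt : ((integralModelInt W).b₆ : ℚ) = W.b₆ := by
  have h := (integralModelInt W).map_b₆ (Int.castRingHom ℚ)
  rw [map_integralModelInt, eq_intCast] at h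
  exact h.symm

variable [W.IsElliptic]

/-- **Good ordinary at `2` ⇒ `b₂` odd**: `b₂ = a₁² + 4a₂` and `a₁` is odd on the minimal equation of a curve with good
ORDINARY reduction at `2` (tree: `odd_a₁_of_hasGoodReductionAtPrime_two_of_odd_frobeniusTrace_two`; Silverman V.4: in
characteristic `2`, supersingular ⟺ `ā₁ = 0`). [cite: SilvermanAEC2009, V.4 (first paragraph) and Exercise 5.10(a)] -/
theorem odd_b₂_of_isOrdinaryAt_two (hord : IsOrdinaryAt W 2) : Odd (integralModelInt W).b₂ := by
  have hodd : Odd (W.frobeniusTrace 2) := by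
    rcases Int.even_or_odd (W.frobeniusTrace 2) with h | h
    · exact absurd (even_iff_two_dvd.mp h) (by exact_mod_cast hord.2)
    · exact h
  have ha₁ := odd_a₁_of_hasGoodReductionAtPrime_two_of_odd_frobeniusTrace_two W hord.1 hodd
  have hb : (integralModelInt W).b₂ = (integralModelInt W).a₁ ^ 2 + 4 * (integralModelInt W).a₂ := rfl
  have h4 : Even (4 * (integralModelInt W).a₂) := ⟨2 * (integralModelInt W).a₂, by ring⟩
  rw [hb]
  exact ha₁.pow.add_even h4

/-- An even integer has `2`-adic norm `< 1` in `ℤ₂`. [folklore] -/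
theorem norm_intCast_padicInt_lt_one_of_even {k : ℤ} (hk : Even k) : ‖(k : ℤ_[2])‖ < 1 := by
  rw [PadicInt.norm_int_lt_one_iff_dvd]
  exact_mod_cast even_iff_two_dvd.mp hk

/-- **Good ordinary reduction at `2` ⇒ the `u`-cubic has an ODD-UNIT root in `ℤ₂`.** On the minimal equation
`c_W = u³ + b₂u² + 8b₄u + 16b₆ ∈ ℤ[u]` with `b₂` odd reduces to `ū²(ū + 1)` modulo `2`; the simple root `ū = 1` lifts by
Hensel's lemma (`c_W(1)` even, `c_W′(1) = 3 + 2b₂ + 8b₄` odd) to a root `e ∈ ℤ₂` with `e ≡ 1 (mod 2)`. The point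
`(e/4, ·)` is the `2`-torsion point of the CANONICAL subgroup (its abscissa `e/4` is non-integral). [cite: SilvermanAEC2009, VII.2 (reduction of torsion; formal group) and V.4] -/
theorem exists_padicInt_root_of_isOrdinaryAt_two (hord : IsOrdinaryAt W 2) :
    ∃ e : ℤ_[2], ‖e‖ = 1 ∧ aeval (e : ℚ_[2]) (twoDivisionUCubic W) = 0 := by
  set M := integralModelInt W with hM
  have hb₂ : Odd M.b₂ := odd_b₂_of_isOrdinaryAt_two W hord
  set F : ℤ[X] := X ^ 3 + C M.b₂ * X ^ 2 + C (8 * M.b₄) * X + C (16 * M.b₆) with hF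
  have hFz : ∀ z : ℤ_[2], F.aeval z =
      z ^ 3 + (M.b₂ : ℤ_[2]) * z ^ 2 + ((8 * M.b₄ : ℤ) : ℤ_[2]) * z + ((16 * M.b₆ : ℤ) : ℤ_[2]) := by
    intro z
    simp only [hF, map_add, map_mul (aeval z), map_pow, aeval_X, aeval_C, algebraMap_int_eq, Int.coe_castRingHom]
  have hF1 : F.aeval (1 : ℤ_[2]) = ((1 + M.b₂ + 8 * M.b₄ + 16 * M.b₆ : ℤ) : ℤ_[2]) := by
    rw [hFz]; push_cast; ring
  have hdF : derivative F = C 3 * X ^ 2 + C (2 * M.b₂) * X + C (8 * M.b₄) := by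
    simp only [hF, derivative_add, derivative_mul, derivative_C, derivative_X_pow, derivative_X, zero_mul,
      zero_add, mul_one, map_mul]
    simp only [Nat.cast_ofNat, Nat.add_one_sub_one, pow_one]
    ring
  have hdF1 : (derivative F).aeval (1 : ℤ_[2]) = ((3 + 2 * M.b₂ + 8 * M.b₄ : ℤ) : ℤ_[2]) := by
    rw [hdF]
    simp only [map_add, map_mul (aeval (1 : ℤ_[2])), map_pow, aeval_X, aeval_C, algebraMap_int_eq,
      Int.coe_castRingHom]
    push_cast
    ring
  have hodd' : Odd (3 + 2 * M.b₂ + 8 * M.b₄) := by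
    have h1 : Even (2 * M.b₂ + 8 * M.b₄) := ⟨M.b₂ + 4 * M.b₄, by ring⟩
    have h3 : Odd (3 : ℤ) := ⟨1, by norm_num⟩
    simpa [add_assoc] using h3.add_even h1
  have heven' : Even (1 + M.b₂ + 8 * M.b₄ + 16 * M.b₆) := by
    have h2 : Even (8 * M.b₄ + 16 * M.b₆) := ⟨4 * M.b₄ + 8 * M.b₆, by ring⟩
    simpa [add_assoc] using (odd_one.add_odd hb₂).add h2
  have hn1 : ‖(derivative F).aeval (1 : ℤ_[2])‖ = 1 := by
    -- an odd integer is a `2`-adic unit (the tree's `PrintCf2.DyadicTorsion.norm_intCast_eq_one_of_odd`, three lines, not imported)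
    rw [hdF1, PadicInt.norm_intCast_eq_one_iff]
    obtain ⟨k, hk⟩ := hodd'
    exact ⟨1, -k, by rw [hk]; ring⟩
  have hnorm : ‖F.aeval (1 : ℤ_[2])‖ < ‖(derivative F).aeval (1 : ℤ_[2])‖ ^ 2 := by
    rw [hn1, one_pow, hF1]
    exact norm_intCast_padicInt_lt_one_of_even heven'
  obtain ⟨z, hz0, hz1, -, -⟩ := hensels_lemma hnorm
  rw [hn1] at hz1
  refine ⟨z, ?_, ?_⟩
  · -- `z = 1 + (z - 1)` with `‖z - 1‖ < 1 = ‖1‖`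
    have h := PadicInt.norm_add_eq_max_of_ne (q := (1 : ℤ_[2])) (r := z - 1) (by rw [norm_one]; exact hz1.ne')
    rw [add_sub_cancel, norm_one, max_eq_left hz1.le] at h
    exact h
  · have h := congrArg ((↑) : ℤ_[2] → ℚ_[2]) hz0
    rw [hFz] at h
    simp only [PadicInt.coe_add, PadicInt.coe_mul, PadicInt.coe_pow, PadicInt.coe_intCast, PadicInt.coe_zero] at h
    push_cast at h
    simp only [twoDivisionUCubic, map_add, map_mul, map_pow, aeval_X, aeval_C, eq_ratCast]
    rw [← ratCast_b₂_integralModelInt, ← ratCast_b₄_integralModelInt, ← ratCast_b₆_integralModelInt]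
    push_cast
    linear_combination h

end Hensel

/-! ## §3 The dictionary on the good-ordinary locus: ON the Kilford stratum ⟺ `Δ ∈ ℚ₂²` -/

section Dictionary

variable (W : WeierstrassCurve ℚ)

/-- Unfolding lemma: `OnKilfordStratumAtTwo W` is the splitting over `ℚ₂` of the mapped `u`-cubic. [folklore] -/
theorem onKilfordStratumAtTwo_iff_splits :
    OnKilfordStratumAtTwo W ↔ ((twoDivisionUCubic W).map (algebraMap ℚ ℚ_[2])).Splits :=
  Iff.rfl

/-- **ON the Kilford stratum ⇒ `Δ(W)` is a square in `ℚ₂`** (every `W/ℚ`, no reduction hypothesis).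
[cite: SilvermanAEC2009, III.1 (Δ = 16·disc of the 2-division cubic)] -/
theorem isSquare_padic_Δ_of_onKilfordStratumAtTwo (h : OnKilfordStratumAtTwo W) : IsSquare (W.Δ : ℚ_[2]) :=
  isSquare_ratCast_Δ_of_splits_map W h

/-- **`Δ(W)` not a square in `ℚ₂` ⇒ `W` is OFF the Kilford stratum** (every `W/ℚ`; the hypothesis is the shape
`∀ s : ℚ_[2], s ^ 2 ≠ Δ` used by the line's `…BuzzardGalois` / Buzzard 2000 Prop. 2.4 road). [folklore] -/
theorem not_onKilfordStratumAtTwo_of_forall_sq_ne (hΔ₂ : ∀ s : ℚ_[2], s ^ 2 ≠ (W.Δ : ℚ_[2])) :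
    ¬ OnKilfordStratumAtTwo W :=
  not_splits_map_of_forall_sq_ne W hΔ₂

variable [W.IsElliptic] [W.IsGloballyMinimal]

/-- **Good ordinary at `2` and `Δ(W) ∈ ℚ₂²` ⇒ ON the Kilford stratum**: the `u`-cubic has the Hensel root of §2, and the
quadratic cofactor splits because its discriminant is `256Δ/c_W′(e)²`, a square. [cite: SilvermanAEC2009, III.1 and VII.2] -/
theorem onKilfordStratumAtTwo_of_isSquare_padic_Δ (hord : IsOrdinaryAt W 2) (hsq : IsSquare (W.Δ : ℚ_[2])) :
    OnKilfordStratumAtTwo W := by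
  obtain ⟨e, -, he⟩ := exists_padicInt_root_of_isOrdinaryAt_two W hord
  exact splits_map_of_root_of_isSquare_ratCast_Δ W he hsq

/-- **THE DICTIONARY.** For `W/ℚ` globally minimal with good ORDINARY reduction at `2`:
`W` is ON the Kilford stratum (its `2`-division `u`-cubic splits over `ℚ₂`, `E[2] ⊆ E(ℚ₂)`) iff `Δ(W)` is a square in
`ℚ₂`. (For such `W` the cubic always has the canonical odd-unit root in `ℚ₂`, §2; the other two roots are in `ℚ₂` iff the
discriminant `256Δ` of the cubic is a `2`-adic square. On a minimal equation good at `2`, `Δ` is odd, so this reads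
`Δ ≡ 1 (mod 8)`.) [cite: SilvermanAEC2009, III.1 and VII.2] -/
theorem onKilfordStratumAtTwo_iff_isSquare_padic_Δ (hord : IsOrdinaryAt W 2) :
    OnKilfordStratumAtTwo W ↔ IsSquare (W.Δ : ℚ_[2]) :=
  ⟨isSquare_padic_Δ_of_onKilfordStratumAtTwo W, onKilfordStratumAtTwo_of_isSquare_padic_Δ W hord⟩

/-- **OFF the stratum ⇒ `Δ ∉ ℚ₂²`** (good ordinary at `2`), in the shape `∀ s : ℚ_[2], s ^ 2 ≠ Δ` consumed by the
line's Buzzard-multiplicity-one road (`…BuzzardGalois.exists_mem_decompositionSubgroup_apply_ne_one_of_not_padicSquare`).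
[cite: SilvermanAEC2009, III.1 and VII.2] -/
theorem forall_sq_ne_of_not_onKilfordStratumAtTwo (hord : IsOrdinaryAt W 2) (h : ¬ OnKilfordStratumAtTwo W) :
    ∀ s : ℚ_[2], s ^ 2 ≠ (W.Δ : ℚ_[2]) := fun s hs ↦
  h (onKilfordStratumAtTwo_of_isSquare_padic_Δ W hord ⟨s, by rw [← hs, sq]⟩)

/-- **THE DICTIONARY, negated form**: for `W/ℚ` globally minimal with good ordinary reduction at `2`,
`¬ OnKilfordStratumAtTwo W ↔ ∀ s : ℚ_[2], s ^ 2 ≠ Δ(W)` — the right side is VERBATIM the local hypothesis `hΔ₂` of the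
line's `…BuzzardGalois` theorems, so «OFF the Kilford stratum» in the route's vocabulary
(`F1Sign2.AnalyticLineTransferAtTwoOffStratum`) and «`Δ` not a `2`-adic square» name the same good-ordinary curves.
[cite: SilvermanAEC2009, III.1 and VII.2] -/
theorem not_onKilfordStratumAtTwo_iff_forall_sq_ne (hord : IsOrdinaryAt W 2) :
    ¬ OnKilfordStratumAtTwo W ↔ ∀ s : ℚ_[2], s ^ 2 ≠ (W.Δ : ℚ_[2]) :=
  ⟨forall_sq_ne_of_not_onKilfordStratumAtTwo W hord, not_onKilfordStratumAtTwo_of_forall_sq_ne W⟩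

/-- **OFF the stratum the `ℚ₂`-root is unique (and is the canonical odd unit).** For `W/ℚ` globally minimal with good
ordinary reduction at `2` OFF the Kilford stratum, the roots of the `u`-cubic in `ℚ₂` form the singleton `{e}` with
`e ∈ ℤ₂^×`: the quadratic cofactor has no root in `ℚ₂` (a root would split it). So off the stratum exactly ONE
`2`-torsion point is `ℚ₂`-rational — the generator of the canonical subgroup — and `ρ̄_{W,2}(D₂)` has order `2`.
[cite: SilvermanAEC2009, III.1 and VII.2] -/
theorem exists_roots_map_eq_singleton_of_not_onKilfordStratumAtTwo (hord : IsOrdinaryAt W 2)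
    (h : ¬ OnKilfordStratumAtTwo W) :
    ∃ e : ℤ_[2], ‖e‖ = 1 ∧ ((twoDivisionUCubic W).map (algebraMap ℚ ℚ_[2])).roots = {(e : ℚ_[2])} := by
  obtain ⟨e, he1, he⟩ := exists_padicInt_root_of_isOrdinaryAt_two W hord
  refine ⟨e, he1, ?_⟩
  have hfac := map_twoDivisionUCubic_eq_mul W he
  obtain ⟨hq2, hqm⟩ := natDegree_cofactor W (e : ℚ_[2])
  have hq0 := hqm.ne_zero
  have hprod0 : (X - C (e : ℚ_[2])) *
      (X ^ 2 + C ((W.b₂ : ℚ_[2]) + e) * X + C ((e : ℚ_[2]) ^ 2 + (W.b₂ : ℚ_[2]) * e + 8 * (W.b₄ : ℚ_[2]))) ≠ 0 :=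
    mul_ne_zero (X_sub_C_ne_zero _) hq0
  rw [hfac, roots_mul hprod0, roots_X_sub_C]
  suffices hq : (X ^ 2 + C ((W.b₂ : ℚ_[2]) + e) * X +
      C ((e : ℚ_[2]) ^ 2 + (W.b₂ : ℚ_[2]) * e + 8 * (W.b₄ : ℚ_[2]))).roots = 0 by
    rw [hq, add_zero]
  refine Multiset.eq_zero_of_forall_notMem fun x hx ↦ h ?_
  rw [mem_roots hq0] at hx
  rw [onKilfordStratumAtTwo_iff_splits, hfac, splits_X_sub_C_mul_iff]
  exact Splits.of_natDegree_eq_two hq2 hx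

end Dictionary

end Summit.BirchSwinnertonDyer.BirchSwinnertonDyer.Theorems.AlignedTransportAtTwoKilfordStratum

end
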